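import Mathlib
import Summits.Ventures.HodgeRepro.Tier4.Common.AdelicDefs
import Summits.Ventures.HodgeRepro.Tier4.Common.AdelicPlaces
import Summits.Ventures.HodgeRepro.Tier4.Common.MixedPlane
import Summits.Ventures.HodgeRepro.Tier4.Common.MixedPlaneKType
import Summits.Ventures.HodgeRepro.Tier4.Common.RowPlane
import Summits.Ventures.HodgeRepro.Tier4.Common.RowTorus

/-!
# Tier4/Common/RowWeights — the archimedean weights `weightAt` are CHARACTERS of the torus of a row plane:
multiplicative, unit-modulus at a real place, continuous

Blind re-derivation cell `pub-hodge-repro`, Tier 4 «prove the step» (README §9–§10), seat t4-typer-2 (gen 3).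
Target tree path `lean/Summits/Ventures/HodgeRepro/Tier4/Common/RowWeights.lean`.  Mathlib + the landed Common
modules; no literature.

WHY.  The `K`-type vocabulary (MixedPlaneKType `weightAt`, `HasKTypeAt`; KTypeSpace `kTypeSpace'`) asks a vector to
transform under the local torus by `κ ↦ weightAt … 0 κ ^ e₊ · weightAt … 1 κ ^ e₋`; that is a NON-VACUOUS condition
only if `weightAt … j` is multiplicative on the torus (otherwise `f (x κ κ') = χ(κκ') f x = χ(κ') χ(κ) f x` forces
`f = 0`), and the `(C, χ)`-projector of `KTypeProjector` needs `χ (a b) = χ a χ b` and `‖χ a‖ = 1` on `C` — the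
caveat recorded on MixedPlaneKType's INDEX row («`weightAt` multiplicativity on the local torus not proved»).  Here it
is PROVED for the row planes `ofLinesRow q a b ε` (the planes of record of L4 since v0.14, `seesawRow` / `mixedRow`),
from RowTorus's block description `exists_block_of_mem_torusT_ofLinesRow`: on the torus `weightAt … j κ = φ_w(x_j) +
φ_w(y_j) ω_w` for the block `x_j • 1 + y_j • ω` of `κ` on the line `j` (`φ_w : 𝔸_k →+* ℂ` the `w`-component read in
`ℂ`), and `ω_w` is a root of `X² − t X + n` under the CM condition `t_w² < 4 n_w` at the real place `w`.

* `adToC w : Ad k →+* ℂ` (`φ_w`), `entryAt_eq_adToC` (`entryAt` IS `φ_w` of the matrix entry), `adToC_algebraMap`,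
  `adToC_im_eq_zero` (real at a real place), `continuous_adToC`;
* `wroot_sq` — `ω_w² = t_w ω_w − n_w` under `t_w² < 4 n_w` at a real place; `conj_wroot`, `wroot_mul_conj`;
* `weightAt_zero_of_mat`, `weightAt_one_of_mat`, `weightAt_of_mat`, `blockWeight`, `blockWeight_mul`, `norm_blockWeight_eq_one` — the two weights on a block-diagonal torus element and the block calculus (`blockOf_mul`, the entry lemmas);
* **`weightAt_mul`** — `weightAt … j (κ κ') = weightAt … j κ · weightAt … j κ'` on `torusT (ofLinesRow q a b ε)`;
* `weightAt_one` — `weightAt … j 1 = 1`;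
* **`norm_weightAt_eq_one`** — `‖weightAt … j κ‖ = 1` on the torus at a real CM place (the norm-one condition of
  RowTorus: `x² + t x y + n y² = 1`);
* `continuous_weightAt`; `weightChar_localTorusAt_mul`, `norm_weightChar_localTorusAt_eq_one` — the product character `κ ↦ weightAt … 0 κ ^ e₊ · weightAt … 1 κ ^ e₋` on the local torus (the `χ` of `kTypeSpace'`'s clause, shape `hχ` / `hu` of KTypeProjector); `IsCMAt q w` — the DISPLAYED CM inequality `t_w² < 4 n_w` (a condition on the datum, not a cited fact);
* **`weightAt_localTorusAt_mul`**, `norm_weightAt_localTorusAt_eq_one` — the same on `localTorusAt W w ≤ torusT W`,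
  in the shape `KTypeProjector.kProj_apply_mul` / `kProj_of_equivariant` consume (`hχ`, `hu`);
* `weightAt'_eq_weightAt_of_mat` — the transported weight `weightAt'` of `κ` is the weight of any `κ'` whose matrix is
  `g′ κ g` (the transport of the identities to `localTorusAt'` is one substitution away for a line that knows its
  similitude `g`).

Hypotheses displayed: `a ≠ 0`, `b ≠ 0`, `ε ≠ 0` (RowTorus), `w.IsReal` and the CM inequality `t_w² < 4 n_w` for the
unit-modulus and root identities (multiplicativity needs the root identity too).  NOT here: compactness of the local
tori; the planes other than `ofLinesRow`.

Nothing here says anything about the status of the Hodge conjecture for CM abelian varieties, which is NOT proved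
(HC_CM is NOT proved by anyone in this repository).
-/

set_option autoImplicit false

noncomputable section

namespace Summit.Ventures.HodgeRepro.Tier4.Common

open NumberField Matrix
open scoped ComplexConjugate

section Component

variable {k : Type} [Field k] [NumberField k]

/-- The `w`-component of an adele, read in `ℂ` through the extension embedding of the completion. -/
def adToC (w : InfinitePlace k) : Ad k →+* ℂ :=
  (InfinitePlace.Completion.extensionEmbedding w).comp (adComponentInf k w)

/-- `entryAt` is `φ_w` of the matrix entry. -/
theorem entryAt_eq_adToC (W : PlaneData k) (w : InfinitePlace k) (κ : GA W) (i j : Fin 4) :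
    entryAt W w κ i j = adToC w (GA.mat W κ i j) := rfl

/-- `φ_w` of a principal adele is the embedding of the element. -/
theorem adToC_algebraMap (w : InfinitePlace k) (x : k) :
    adToC w (algebraMap k (Ad k) x) = InfinitePlace.Completion.extensionEmbedding w (algebraMap k w.Completion x) :=
  rfl

/-- At a real place `φ_w` takes real values. -/
theorem adToC_im_eq_zero {w : InfinitePlace k} (hw : w.IsReal) (x : Ad k) : (adToC w x).im = 0 := by
  show (InfinitePlace.Completion.extensionEmbedding w (adComponentInf k w x)).im = 0
  rw [← InfinitePlace.Completion.extensionEmbeddingOfIsReal_apply hw, Complex.ofReal_im]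

omit [NumberField k] in
/-- At a real place the embedding of a completion element is real. -/
theorem extensionEmbedding_im_eq_zero {w : InfinitePlace k} (hw : w.IsReal) (x : w.Completion) :
    (InfinitePlace.Completion.extensionEmbedding w x).im = 0 := by
  rw [← InfinitePlace.Completion.extensionEmbeddingOfIsReal_apply hw, Complex.ofReal_im]

/-- `φ_w` is continuous. -/
theorem continuous_adToC (w : InfinitePlace k) : Continuous (adToC w) := by
  refine (InfinitePlace.Completion.isometry_extensionEmbedding w).continuous.comp ?_
  exact (continuous_apply w).comp continuous_fst

/-- The entries of `κ ∈ G(𝔸_k)` are continuous. -/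
theorem continuous_mat_entry (W : PlaneData k) (i j : Fin 4) : Continuous fun κ : GA W => GA.mat W κ i j :=
  (Units.continuous_val.comp continuous_subtype_val).matrix_elem i j

/-- `entryAt` is continuous in `κ`. -/
theorem continuous_entryAt (W : PlaneData k) (w : InfinitePlace k) (i j : Fin 4) :
    Continuous fun κ : GA W => entryAt W w κ i j :=
  (continuous_adToC w).comp (continuous_mat_entry W i j)

end Component

section Root

variable {k : Type} [Field k] [NumberField k] (q : QuadData k) (w : InfinitePlace k)

/-- `t_w ∈ ℂ`, the embedding of `q.t` at `w`. -/
def tAt : ℂ := InfinitePlace.Completion.extensionEmbedding w (algebraMap k w.Completion q.t)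

/-- `n_w ∈ ℂ`, the embedding of `q.n` at `w`. -/
def nAt : ℂ := InfinitePlace.Completion.extensionEmbedding w (algebraMap k w.Completion q.n)

/-- **The CM condition at a real place**: `t_w² < 4 n_w` (the quadratic `X² − t X + n` has no real root at `w`). -/
def IsCMAt : Prop := (tAt q w).re ^ 2 < 4 * (nAt q w).re

/-- `φ_w` of the principal adele `q.t` is `t_w`. -/
theorem adToC_t : adToC w (algebraMap k (Ad k) q.t) = tAt q w := rfl

/-- `φ_w` of the principal adele `q.n` is `n_w`. -/
theorem adToC_n : adToC w (algebraMap k (Ad k) q.n) = nAt q w := rfl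

omit [NumberField k] in
/-- `wroot` unfolded in `t_w`, `n_w`. -/
theorem wroot_eq : wroot q w =
    (tAt q w + Complex.I * Real.sqrt (4 * (nAt q w).re - (tAt q w).re ^ 2)) / 2 := rfl

variable {q w}

omit [NumberField k] in
/-- At a real place `t_w` is real. -/
theorem tAt_eq_re (hw : w.IsReal) : tAt q w = ((tAt q w).re : ℂ) := by
  apply Complex.ext
  · simp
  · simp only [Complex.ofReal_im]
    exact extensionEmbedding_im_eq_zero hw _

omit [NumberField k] in
/-- At a real place `n_w` is real. -/
theorem nAt_eq_re (hw : w.IsReal) : nAt q w = ((nAt q w).re : ℂ) := by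
  apply Complex.ext
  · simp
  · simp only [Complex.ofReal_im]
    exact extensionEmbedding_im_eq_zero hw _

omit [NumberField k] in
/-- **`ω_w` is a root of `X² − t_w X + n_w`** at a real CM place. -/
theorem wroot_sq (hw : w.IsReal) (hcm : IsCMAt q w) : wroot q w ^ 2 = tAt q w * wroot q w - nAt q w := by
  set tr := (tAt q w).re with htr
  set nr := (nAt q w).re with hnr
  set s := Real.sqrt (4 * nr - tr ^ 2) with hs
  have hs2 : s ^ 2 = 4 * nr - tr ^ 2 := Real.sq_sqrt (by unfold IsCMAt at hcm; linarith)
  have hsC : (s : ℂ) ^ 2 = 4 * (nr : ℂ) - (tr : ℂ) ^ 2 := by exact_mod_cast hs2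
  rw [wroot_eq, tAt_eq_re hw, nAt_eq_re hw]
  linear_combination (1 / 4 : ℂ) * (s : ℂ) ^ 2 * Complex.I_sq - (1 / 4 : ℂ) * hsC

omit [NumberField k] in
/-- The conjugate root: `conj ω_w = t_w − ω_w` at a real place. -/
theorem conj_wroot (hw : w.IsReal) : conj (wroot q w) = tAt q w - wroot q w := by
  rw [wroot_eq, tAt_eq_re hw]
  simp only [map_div₀, map_add, map_mul, Complex.conj_ofReal, Complex.conj_I, map_ofNat]
  ring

omit [NumberField k] in
/-- `ω_w · conj ω_w = n_w` at a real CM place. -/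
theorem wroot_mul_conj (hw : w.IsReal) (hcm : IsCMAt q w) : wroot q w * conj (wroot q w) = nAt q w := by
  rw [conj_wroot hw]
  linear_combination -(wroot_sq hw hcm)

end Root

section RowTorus

variable {k : Type} [Field k] [NumberField k] (q : QuadData k) (a b ε : k)

/-- The torus-block entries, `(0,0)`. -/
theorem blockDiag4R_apply_zero_zero {R : Type} [CommRing R] (A D : Matrix (Fin 2) (Fin 2) R) :
    blockDiag4R A D 0 0 = A 0 0 := rfl

/-- The torus-block entries, `(1,0)`. -/
theorem blockDiag4R_apply_one_zero {R : Type} [CommRing R] (A D : Matrix (Fin 2) (Fin 2) R) :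
    blockDiag4R A D 1 0 = A 1 0 := rfl

/-- The torus-block entries, `(2,2)`. -/
theorem blockDiag4R_apply_two_two {R : Type} [CommRing R] (A D : Matrix (Fin 2) (Fin 2) R) :
    blockDiag4R A D 2 2 = D 0 0 := rfl

/-- The torus-block entries, `(3,2)`. -/
theorem blockDiag4R_apply_three_two {R : Type} [CommRing R] (A D : Matrix (Fin 2) (Fin 2) R) :
    blockDiag4R A D 3 2 = D 1 0 := rfl

/-- The `(0,0)` entry of `x • 1 + y • ω`. -/
theorem blockOf_apply_zero_zero {R : Type} [CommRing R] (t n x y : R) : blockOf t n x y 0 0 = x := by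
  simp [blockOf, omegaMatR]

/-- The `(1,0)` entry of `x • 1 + y • ω`. -/
theorem blockOf_apply_one_zero {R : Type} [CommRing R] (t n x y : R) : blockOf t n x y 1 0 = y := by
  simp [blockOf, omegaMatR]

/-- **The product of two blocks** `(x + y ω)(x' + y' ω) = (x x' − n y y') + (x y' + y x' + t y y') ω`. -/
theorem blockOf_mul {R : Type} [CommRing R] (t n x y x' y' : R) :
    blockOf t n x y * blockOf t n x' y' = blockOf t n (x * x' - n * y * y') (x * y' + y * x' + t * y * y') := by
  ext i j
  fin_cases i <;> fin_cases j <;> simp [blockOf, omegaMatR, Matrix.mul_apply, Fin.sum_univ_two] <;> ring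

variable (w : InfinitePlace k)

/-- The block description of a torus element, packaged as entries: `mat κ = blockDiag4R (blockOf x₀ y₀) (blockOf x₁ y₁)`
with the norm-one conditions (RowTorus, restated with `blockOf`). -/
theorem exists_blockOf_of_mem_torusT (ha : a ≠ 0) (hb : b ≠ 0) (hε : ε ≠ 0)
    (κ : GA (PlaneData.ofLinesRow q a b ε)) (hκ : κ ∈ torusT (PlaneData.ofLinesRow q a b ε)) :
    ∃ x₀ y₀ x₁ y₁ : Ad k,
      GA.mat (PlaneData.ofLinesRow q a b ε) κ =
        blockDiag4R (blockOf (algebraMap k (Ad k) q.t) (algebraMap k (Ad k) q.n) x₀ y₀)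
          (blockOf (algebraMap k (Ad k) q.t) (algebraMap k (Ad k) q.n) x₁ y₁) ∧
      x₀ ^ 2 + algebraMap k (Ad k) q.t * x₀ * y₀ + algebraMap k (Ad k) q.n * y₀ ^ 2 = 1 ∧
      x₁ ^ 2 + algebraMap k (Ad k) q.t * x₁ * y₁ + algebraMap k (Ad k) q.n * y₁ ^ 2 = 1 :=
  exists_block_of_mem_torusT_ofLinesRow q a b ε ha hb hε κ hκ

/-- `weightAt … 0` of a block-diagonal element `blockDiag4R (blockOf x₀ y₀) (blockOf x₁ y₁)` is `φ_w x₀ + φ_w y₀ ω_w`. -/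
theorem weightAt_zero_of_mat (W : PlaneData k) (κ : GA W) (x₀ y₀ x₁ y₁ : Ad k)
    (h : GA.mat W κ = blockDiag4R (blockOf (algebraMap k (Ad k) q.t) (algebraMap k (Ad k) q.n) x₀ y₀)
      (blockOf (algebraMap k (Ad k) q.t) (algebraMap k (Ad k) q.n) x₁ y₁)) :
    weightAt W q w 0 κ = adToC w x₀ + adToC w y₀ * wroot q w := by
  have h0 : lineBase 0 = 0 := rfl
  have h1 : lineOmega 0 = 1 := rfl
  simp only [weightAt, h0, h1, entryAt_eq_adToC, h, blockDiag4R_apply_zero_zero, blockDiag4R_apply_one_zero,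
    blockOf_apply_zero_zero, blockOf_apply_one_zero]

/-- `weightAt … 1` of a block-diagonal element is `φ_w x₁ + φ_w y₁ ω_w`. -/
theorem weightAt_one_of_mat (W : PlaneData k) (κ : GA W) (x₀ y₀ x₁ y₁ : Ad k)
    (h : GA.mat W κ = blockDiag4R (blockOf (algebraMap k (Ad k) q.t) (algebraMap k (Ad k) q.n) x₀ y₀)
      (blockOf (algebraMap k (Ad k) q.t) (algebraMap k (Ad k) q.n) x₁ y₁)) :
    weightAt W q w 1 κ = adToC w x₁ + adToC w y₁ * wroot q w := by
  have h0 : lineBase 1 = 2 := rfl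
  have h1 : lineOmega 1 = 3 := rfl
  simp only [weightAt, h0, h1, entryAt_eq_adToC, h, blockDiag4R_apply_two_two, blockDiag4R_apply_three_two,
    blockOf_apply_zero_zero, blockOf_apply_one_zero]

/-- The weight of a block `x + y ω` read in `ℂ`. -/
def blockWeight (x y : Ad k) : ℂ := adToC w x + adToC w y * wroot q w

/-- `weightAt` on either line, given the block description. -/
theorem weightAt_of_mat (W : PlaneData k) (κ : GA W) (x₀ y₀ x₁ y₁ : Ad k)
    (h : GA.mat W κ = blockDiag4R (blockOf (algebraMap k (Ad k) q.t) (algebraMap k (Ad k) q.n) x₀ y₀)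
      (blockOf (algebraMap k (Ad k) q.t) (algebraMap k (Ad k) q.n) x₁ y₁)) (j : Fin 2) :
    weightAt W q w j κ = if j = 0 then blockWeight q w x₀ y₀ else blockWeight q w x₁ y₁ := by
  fin_cases j
  · simp only [Fin.zero_eta, blockWeight]
    exact weightAt_zero_of_mat q w W κ x₀ y₀ x₁ y₁ h
  · simp only [Fin.mk_one, one_ne_zero, if_false, blockWeight]
    exact weightAt_one_of_mat q w W κ x₀ y₀ x₁ y₁ h

/-- **The block weight is multiplicative** under the root identity: `(φx + φy ω)(φx' + φy' ω)` is the weight of the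
product block `(x x' − n y y', x y' + y x' + t y y')`. -/
theorem blockWeight_mul (hw : w.IsReal) (hcm : IsCMAt q w) (x y x' y' : Ad k) :
    blockWeight q w (x * x' - algebraMap k (Ad k) q.n * y * y')
        (x * y' + y * x' + algebraMap k (Ad k) q.t * y * y') =
      blockWeight q w x y * blockWeight q w x' y' := by
  simp only [blockWeight, map_add, map_sub, map_mul, adToC_t, adToC_n]
  have hsq := wroot_sq hw hcm
  linear_combination (-(adToC w y * adToC w y')) * hsq

/-- **`weightAt … j` is multiplicative on the torus of a row plane** (real CM place `w`). -/
theorem weightAt_mul (ha : a ≠ 0) (hb : b ≠ 0) (hε : ε ≠ 0) (hw : w.IsReal) (hcm : IsCMAt q w) (j : Fin 2)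
    {κ κ' : GA (PlaneData.ofLinesRow q a b ε)} (hκ : κ ∈ torusT (PlaneData.ofLinesRow q a b ε))
    (hκ' : κ' ∈ torusT (PlaneData.ofLinesRow q a b ε)) :
    weightAt (PlaneData.ofLinesRow q a b ε) q w j (κ * κ') =
      weightAt (PlaneData.ofLinesRow q a b ε) q w j κ * weightAt (PlaneData.ofLinesRow q a b ε) q w j κ' := by
  obtain ⟨x₀, y₀, x₁, y₁, hm, -, -⟩ := exists_blockOf_of_mem_torusT q a b ε ha hb hε κ hκ
  obtain ⟨x₀', y₀', x₁', y₁', hm', -, -⟩ := exists_blockOf_of_mem_torusT q a b ε ha hb hε κ' hκ'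
  have hmm : GA.mat (PlaneData.ofLinesRow q a b ε) (κ * κ') =
      blockDiag4R (blockOf (algebraMap k (Ad k) q.t) (algebraMap k (Ad k) q.n)
          (x₀ * x₀' - algebraMap k (Ad k) q.n * y₀ * y₀') (x₀ * y₀' + y₀ * x₀' + algebraMap k (Ad k) q.t * y₀ * y₀'))
        (blockOf (algebraMap k (Ad k) q.t) (algebraMap k (Ad k) q.n)
          (x₁ * x₁' - algebraMap k (Ad k) q.n * y₁ * y₁') (x₁ * y₁' + y₁ * x₁' + algebraMap k (Ad k) q.t * y₁ * y₁')) := by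
    rw [GA.mat_mul, hm, hm', blockDiag4R_mul, blockOf_mul, blockOf_mul]
  rw [weightAt_of_mat q w _ _ _ _ _ _ hmm j, weightAt_of_mat q w _ _ _ _ _ _ hm j, weightAt_of_mat q w _ _ _ _ _ _ hm' j]
  fin_cases j
  · simp only [Fin.zero_eta]
    exact blockWeight_mul q w hw hcm x₀ y₀ x₀' y₀'
  · simp only [Fin.mk_one, one_ne_zero, if_false]
    exact blockWeight_mul q w hw hcm x₁ y₁ x₁' y₁'

/-- `weightAt … j 1 = 1` on any plane. -/
theorem weightAt_one (W : PlaneData k) (j : Fin 2) : weightAt W q w j (1 : GA W) = 1 := by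
  have h : GA.mat W (1 : GA W) = blockDiag4R (blockOf (algebraMap k (Ad k) q.t) (algebraMap k (Ad k) q.n) 1 0)
      (blockOf (algebraMap k (Ad k) q.t) (algebraMap k (Ad k) q.n) 1 0) := by
    have h1 : blockOf (algebraMap k (Ad k) q.t) (algebraMap k (Ad k) q.n) (1 : Ad k) 0 = 1 := by
      simp [blockOf]
    rw [h1, blockDiag4R_one]
    rfl
  rw [weightAt_of_mat q w W 1 1 0 1 0 h j]
  simp [blockWeight]

/-- **The block weight has modulus one** when the block is norm-one and the components are real: `‖φx + φy ω‖² =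
φx² + t_w φx φy + n_w φy² = φ(x² + t x y + n y²) = 1`. -/
theorem norm_blockWeight_eq_one (hw : w.IsReal) (hcm : IsCMAt q w) (x y : Ad k)
    (hN : x ^ 2 + algebraMap k (Ad k) q.t * x * y + algebraMap k (Ad k) q.n * y ^ 2 = 1) :
    ‖blockWeight q w x y‖ = 1 := by
  have hx : conj (adToC w x) = adToC w x := Complex.conj_eq_iff_im.2 (adToC_im_eq_zero hw x)
  have hy : conj (adToC w y) = adToC w y := Complex.conj_eq_iff_im.2 (adToC_im_eq_zero hw y)
  have hN' := congrArg (adToC w) hN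
  simp only [map_add, map_mul, map_pow, map_one, adToC_t, adToC_n] at hN'
  have hsq : blockWeight q w x y * conj (blockWeight q w x y) = 1 := by
    simp only [blockWeight, map_add, map_mul, hx, hy, conj_wroot hw]
    have hmc := wroot_mul_conj hw hcm
    rw [conj_wroot hw] at hmc
    linear_combination hN' + (adToC w y) ^ 2 * hmc
  rw [Complex.mul_conj'] at hsq
  have h2 : ‖blockWeight q w x y‖ ^ 2 = 1 := by exact_mod_cast hsq
  exact (pow_eq_one_iff_of_nonneg (norm_nonneg _) two_ne_zero).1 h2

/-- **`‖weightAt … j κ‖ = 1` on the torus of a row plane** at a real CM place. -/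
theorem norm_weightAt_eq_one (ha : a ≠ 0) (hb : b ≠ 0) (hε : ε ≠ 0) (hw : w.IsReal) (hcm : IsCMAt q w) (j : Fin 2)
    {κ : GA (PlaneData.ofLinesRow q a b ε)} (hκ : κ ∈ torusT (PlaneData.ofLinesRow q a b ε)) :
    ‖weightAt (PlaneData.ofLinesRow q a b ε) q w j κ‖ = 1 := by
  obtain ⟨x₀, y₀, x₁, y₁, hm, hN₀, hN₁⟩ := exists_blockOf_of_mem_torusT q a b ε ha hb hε κ hκ
  rw [weightAt_of_mat q w _ _ _ _ _ _ hm j]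
  fin_cases j
  · simp only [Fin.zero_eta]
    exact norm_blockWeight_eq_one q w hw hcm x₀ y₀ hN₀
  · simp only [Fin.mk_one, one_ne_zero, if_false]
    exact norm_blockWeight_eq_one q w hw hcm x₁ y₁ hN₁

/-- `weightAt … j` is continuous on `G(𝔸_k)`. -/
theorem continuous_weightAt (W : PlaneData k) (j : Fin 2) : Continuous fun κ : GA W => weightAt W q w j κ :=
  (continuous_entryAt W w _ _).add ((continuous_entryAt W w _ _).mul continuous_const)

/-- The multiplicativity on the local torus `localTorusAt W w' ≤ torusT W`, in the shape of `KTypeProjector`'s `hχ`. -/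
theorem weightAt_localTorusAt_mul (ha : a ≠ 0) (hb : b ≠ 0) (hε : ε ≠ 0) (hw : w.IsReal) (hcm : IsCMAt q w)
    (j : Fin 2) (w' : InfinitePlace k) :
    ∀ κ ∈ localTorusAt (PlaneData.ofLinesRow q a b ε) w', ∀ κ' ∈ localTorusAt (PlaneData.ofLinesRow q a b ε) w',
      weightAt (PlaneData.ofLinesRow q a b ε) q w j (κ * κ') =
        weightAt (PlaneData.ofLinesRow q a b ε) q w j κ * weightAt (PlaneData.ofLinesRow q a b ε) q w j κ' :=
  fun _ hκ _ hκ' => weightAt_mul q a b ε w ha hb hε hw hcm j hκ.1 hκ'.1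

/-- The unit modulus on the local torus, in the shape of `KTypeProjector`'s `hu`. -/
theorem norm_weightAt_localTorusAt_eq_one (ha : a ≠ 0) (hb : b ≠ 0) (hε : ε ≠ 0) (hw : w.IsReal) (hcm : IsCMAt q w)
    (j : Fin 2) (w' : InfinitePlace k) :
    ∀ κ ∈ localTorusAt (PlaneData.ofLinesRow q a b ε) w', ‖weightAt (PlaneData.ofLinesRow q a b ε) q w j κ‖ = 1 :=
  fun _ hκ => norm_weightAt_eq_one q a b ε w ha hb hε hw hcm j hκ.1

/-- The product character `κ ↦ weightAt … 0 κ ^ e₊ · weightAt … 1 κ ^ e₋` is multiplicative on the local torus. -/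
theorem weightChar_localTorusAt_mul (ha : a ≠ 0) (hb : b ≠ 0) (hε : ε ≠ 0) (hw : w.IsReal) (hcm : IsCMAt q w)
    (ePlus eMinus : ℤ) (w' : InfinitePlace k) :
    ∀ κ ∈ localTorusAt (PlaneData.ofLinesRow q a b ε) w', ∀ κ' ∈ localTorusAt (PlaneData.ofLinesRow q a b ε) w',
      weightAt (PlaneData.ofLinesRow q a b ε) q w 0 (κ * κ') ^ ePlus *
          weightAt (PlaneData.ofLinesRow q a b ε) q w 1 (κ * κ') ^ eMinus =
        (weightAt (PlaneData.ofLinesRow q a b ε) q w 0 κ ^ ePlus *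
            weightAt (PlaneData.ofLinesRow q a b ε) q w 1 κ ^ eMinus) *
          (weightAt (PlaneData.ofLinesRow q a b ε) q w 0 κ' ^ ePlus *
            weightAt (PlaneData.ofLinesRow q a b ε) q w 1 κ' ^ eMinus) := by
  intro κ hκ κ' hκ'
  rw [weightAt_mul q a b ε w ha hb hε hw hcm 0 hκ.1 hκ'.1, weightAt_mul q a b ε w ha hb hε hw hcm 1 hκ.1 hκ'.1,
    mul_zpow, mul_zpow]
  ring

/-- The product character has modulus one on the local torus. -/
theorem norm_weightChar_localTorusAt_eq_one (ha : a ≠ 0) (hb : b ≠ 0) (hε : ε ≠ 0) (hw : w.IsReal)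
    (hcm : IsCMAt q w) (ePlus eMinus : ℤ) (w' : InfinitePlace k) :
    ∀ κ ∈ localTorusAt (PlaneData.ofLinesRow q a b ε) w',
      ‖weightAt (PlaneData.ofLinesRow q a b ε) q w 0 κ ^ ePlus *
        weightAt (PlaneData.ofLinesRow q a b ε) q w 1 κ ^ eMinus‖ = 1 := by
  intro κ hκ
  rw [norm_mul, norm_zpow, norm_zpow, norm_weightAt_eq_one q a b ε w ha hb hε hw hcm 0 hκ.1,
    norm_weightAt_eq_one q a b ε w ha hb hε hw hcm 1 hκ.1, _root_.one_zpow, _root_.one_zpow, one_mul]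

end RowTorus

section Transported

variable {k : Type} [Field k] [NumberField k] (q : QuadData k) (w : InfinitePlace k)

/-- The map of matrices `𝔸_k → k_w` on a principal matrix is the principal matrix at `w`. -/
theorem adMat_map_adComponentInf (g : Matrix (Fin 4) (Fin 4) k) :
    (adMat k g).map (adComponentInf k w) = g.map (algebraMap k w.Completion) := by
  rw [adMat, Matrix.map_map]
  rfl

/-- **The transported weight is the weight of the conjugate**: if `mat κ' = g′ (mat κ) g`, then
`weightAt' W' q w g g' j κ = weightAt W q w j κ'` (the entries of `g′ κ_w g` are the entries of `κ'_w`). -/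
theorem weightAt'_eq_weightAt_of_mat (W W' : PlaneData k) (g g' : Matrix (Fin 4) (Fin 4) k) (κ : GA W')
    (κ' : GA W) (h : GA.mat W κ' = adMat k g' * GA.mat W' κ * adMat k g) (j : Fin 2) :
    weightAt' W' q w g g' j κ = weightAt W q w j κ' := by
  have hentry : ∀ i l : Fin 4, entryAtConj W' w g g' κ i l = entryAt W w κ' i l := by
    intro i l
    simp only [entryAtConj, entryAt_eq_adToC, adToC, RingHom.comp_apply, h]
    congr 1
  simp only [weightAt', weightAt, hentry]

end Transported

end Summit.Ventures.HodgeRepro.Tier4.Common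

end
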